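import Literature.NumberTheory.GaloisRepresentations.BrauerGroupCocycles
import Literature.NumberTheory.GaloisRepresentations.HasseNormCyclicCompletion
import Literature.NumberTheory.GaloisRepresentations.HasseNormCyclicArchimedean
import Literature.NumberTheory.GaloisRepresentations.CyclicClassRestrict
import Literature.NumberTheory.GaloisRepresentations.HilbertNinetySubgroup
import HarnessLib

/-!
# The cyclic step of the Hasse principle for `H²(K, K̄ˣ)` (Albert–Brauer–Hasse–Noether)

Topic `NumberTheory/GaloisRepresentations` (Galois cohomology of number fields); namespace
`Literature.NumberTheory.GaloisRepresentations`.  Proof file: theorems only (no definition, no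
instance, no named fact; D-0026).

The Hasse principle for the Brauer group of a number field, `Br(K) ↪ ⊕_v Br(K_v)`
(Albert–Brauer–Hasse–Noether; Cassels–Fröhlich VII §9.6 / §11.2 (bis); NSW (8.1.17)), is proved
layer by layer; this file is the **cyclic layer**: for a cyclic `E₀/K` the kernel of
`H²(Γ_K, K̄ˣ) → H²(Γ_{E₀}, K̄ˣ)` consists of the cyclic classes `κ_χ(a) = (χ, a)`, `a ∈ Kˣ`
(Serre, *Corps locaux* XIV §1: `Br(E₀/K) ≅ Kˣ / N E₀ˣ`), the local components of `(χ, a)` are the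
local norm residue symbols, and Hasse's norm theorem converts "`a` is a local norm everywhere" into
"`a` is a global norm", i.e. `κ_χ(a) = 0`.  In the tree's language (explicit cocycles of
`BrauerGroupCocycles.lean`; cyclic classes of `CyclicLayerCarry` / `CyclicLayerSurjective` /
`CyclicClassRestrict`; the completion form of Hasse's norm theorem `HasseNormCyclicCompletion` /
`HasseNormCyclicArchimedean`):

* `map_cyclicClass_eq_cyclicClass_derived'` — functoriality of cyclic classes along a compatible
  pair with change of coefficients (`H²(φ, f) κ_χ(a) = κ_ψ(f a)`, `ψ` the derived character);
* `exists_units_map_algebraMap_eq` (`H⁰(Γ_K, K̄ˣ) = Kˣ`), `comap_galFixing_eq` (the preimage in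
  `Γ_L` of `Gal(K̄/E₀)` is `Gal(L̄/L(E₀))`), `restrictNormalHom_eq_one_iff`,
  `prod_pow_smul_eq_algebraMap_norm` (`∏_{j<d} sʲ k = N_{E₀/K} k` along the layer),
  `isCyclic_of_cyclicLayer`, `cycNorm_ofUnits`, `coe_prod_pow_smul`;
* `exists_localNormData` — **local analysis** over any extension `L/K` (a completion): if `[e] =
  κ_χ(a)` and `e` becomes a coboundary over `L`, then `κ_ψ(a) = 0` over `Γ_L` and (Hilbert 90 +
  `exists_cycNorm_eq_of_cyclicClass_eq_zero`) `a = ∏_{k<n} sᵏ b` with `b ∈ L(E₀)`, the `sᵏ`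
  representing `Γ_L / Gal(L̄/L(E₀))` — the local input of `IdeleHerbrand.hasseNorm_of_local`;
* `twoCocycle_cob_of_cyclicLayer` — **the cyclic step**: a locally constant `2`-cocycle of `Γ_K`
  which dies on `Gal(K̄/E₀)` (`E₀/K` the field of a cyclic layer `χ`) and is locally a coboundary at
  every place of the number field `K` is a coboundary.

## References

* J. W. S. Cassels, A. Fröhlich (eds.), *Algebraic Number Theory* (1967), Ch. VII (J. Tate) §9.6
  (Hasse norm theorem and the Hasse principle for cyclic algebras), §11.2. [CasselsFrohlichANT1967]
* J.-P. Serre, *Corps locaux* / *Local Fields* (1979), XIII §3 Prop. 7, XIV §1 Prop. 2–3.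
  [SerreLocalFields1979]
* J. Neukirch, A. Schmidt, K. Wingberg, *Cohomology of Number Fields* (2008), (8.1.17).
  [NeukirchSchmidtWingberg2008]
-/

noncomputable section

open CategoryTheory Topology NumberField IsDedekindDomain

universe u

namespace Literature.NumberTheory.GaloisRepresentations

open _root_.TopRep _root_.ContRepresentation _root_.ContinuousCohomology DiscreteGaloisModule Field
  LocalWeilDatum

/-! ### Functoriality of cyclic classes along a compatible pair with change of coefficients -/

section MapCyclic

variable {G : Type u} [Group G] [TopologicalSpace G] [IsTopologicalGroup G] [LocallyCompactSpace G]
variable {H : Type u} [Group H] [TopologicalSpace H] [IsTopologicalGroup H] [LocallyCompactSpace H]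
variable {d : ℕ} [NeZero d] (χ : CyclicCharacter G d) (φ : H →ₜ* G)
variable {A : Type u} [AddCommGroup A] [TopologicalSpace A] [DiscreteTopology A]
variable {A' : Type u} [AddCommGroup A'] [TopologicalSpace A'] [DiscreteTopology A']
variable (ρ : ContinuousRep G ℤ A) (ρ' : ContinuousRep H ℤ A')

/-- **Restriction with change of coefficients sends a cyclic class to the cyclic class of the
derived character**: for a compatible pair `(φ : H → G, f : A → A')`,
`H²(φ, f)(κ_χ(a)) = κ_ψ(f a)` with `ψ` the derived character of `χ ∘ φ` (as
`map_cyclicClass_eq_cyclicClass_derived`, which is the case `A' = A`, `f = id`).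
[cite: SerreLocalFields1979, XIII §3 Prop. 7; SerreGaloisCohomology1997, I §2.4] -/
theorem map_cyclicClass_eq_cyclicClass_derived'
    (f : TopRep.res ((φ : H →ₜ* G) : H →* G) ρ.toTopRep ⟶ ρ'.toTopRep)
    (a : ρ.toTopRep.ρ.invariants) (a' : ρ'.toTopRep.ρ.invariants) (haa : (a' : A') = f.hom a) :
    ContinuousCohomology.map φ f 2 (cyclicClass χ ρ a) = cyclicClass (χ.derived φ) ρ' a' := by
  rw [cyclicClass_apply, cyclicClass_apply, map_twoCocycleClass]
  refine congrArg _ (Subtype.ext (ContinuousMap.ext fun q => ?_))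
  obtain ⟨σ, τ⟩ := q
  rw [contTwoCocycles.pullback_apply, carryCocycle_apply, carryCocycle_apply, map_zsmul,
    χ.carryFun_derived φ, haa]

end MapCyclic

/-! ### Galois-theoretic lemmas -/

section Galois

variable (K : Type u) [Field K] [CharZero K]

/-- **`H⁰(Γ_K, K̄ˣ) = Kˣ`**: a unit of `K̄` fixed by `Γ_K` comes from `K` (`K̄/K` is Galois in
characteristic `0`). [cite: SerreGaloisCohomology1997, II §1.1] -/
theorem exists_units_map_algebraMap_eq (u : (AlgebraicClosure K)ˣ)
    (h : ∀ σ : absoluteGaloisGroup K, σ • u = u) :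
    ∃ a : Kˣ, Units.map (algebraMap K (AlgebraicClosure K) : K →* AlgebraicClosure K) a = u := by
  haveI : IsGalois K (AlgebraicClosure K) := IsGalois.mk
  have hmem : (u : AlgebraicClosure K) ∈ (⊥ : IntermediateField K (AlgebraicClosure K)) := by
    rw [← InfiniteGalois.fixedField_fixingSubgroup (⊥ : IntermediateField K (AlgebraicClosure K)),
      IntermediateField.fixingSubgroup_bot, IntermediateField.mem_fixedField_iff]
    intro g _
    have := congrArg (fun v : (AlgebraicClosure K)ˣ => (v : AlgebraicClosure K)) (h g)
    rw [Units.coe_smul] at this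
    exact this
  obtain ⟨a₀, ha₀⟩ := IntermediateField.mem_bot.mp hmem
  have ha0 : a₀ ≠ 0 := by
    rintro rfl
    rw [map_zero] at ha₀
    exact u.ne_zero ha₀.symm
  exact ⟨Units.mk0 a₀ ha0, Units.ext ha₀⟩

variable {K}

omit [CharZero K] in
/-- **The decomposition group of the layer cut out by `E₀` in `Γ_L`**: the preimage under
`Γ_L → Γ_K` of `Gal(K̄/E₀)` is `Gal(L̄ / L(E₀))` for the compositum `L(E₀) ⊆ L̄` of `L` and the image
of `E₀` (along the chosen `K̄ → L̄`). [cite: CasselsFrohlichANT1967, Ch. II §10] -/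
theorem comap_galFixing_eq (L : Type u) [Field L] [Algebra K L]
    (E₀ : IntermediateField K (AlgebraicClosure K)) :
    (galFixing K E₀).comap ((absGaloisRestrict K L : absoluteGaloisGroup L →ₜ* absoluteGaloisGroup K) :
        absoluteGaloisGroup L →* absoluteGaloisGroup K) =
      galFixing L (IntermediateField.adjoin L (Set.range ((absClosureEmbedding K L).comp E₀.val))) := by
  ext dd
  rw [Subgroup.mem_comap, mem_galFixing_iff, mem_galFixing_iff]
  constructor
  · intro h y hy
    refine smul_eq_self_of_mem_adjoin L ?_ hy
    rintro _ ⟨x, rfl⟩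
    change dd • absClosureEmbedding K L (x : AlgebraicClosure K) = absClosureEmbedding K L x
    rw [← absGaloisRestrict_apply_smul]
    exact congrArg _ (h x x.2)
  · intro h x hx
    apply (absClosureEmbedding K L).toRingHom.injective
    change absClosureEmbedding K L (absGaloisRestrict K L dd • x) = absClosureEmbedding K L x
    rw [absGaloisRestrict_apply_smul]
    exact h _ (IntermediateField.subset_adjoin _ _ ⟨⟨x, hx⟩, rfl⟩)

omit [CharZero K] in
/-- `Gal(K̄/E₀) ≤ Γ_K` is the kernel of the restriction `Γ_K → Gal(E₀/K)` for `E₀/K` normal. [folklore] -/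
theorem restrictNormalHom_eq_one_iff (E₀ : IntermediateField K (AlgebraicClosure K)) [Normal K E₀]
    (σ : absoluteGaloisGroup K) :
    AlgEquiv.restrictNormalHom E₀ (absoluteGaloisGroup.toAlgEquiv K σ) = 1 ↔ σ ∈ galFixing K E₀ := by
  rw [mem_galFixing_iff, ← MonoidHom.mem_ker, IntermediateField.restrictNormalHom_ker,
    IntermediateField.mem_fixingSubgroup_iff]
  rfl

/-- **The Galois norm along a cyclic layer**: for `E₀/K` finite Galois inside `K̄` with
`Gal(K̄/E₀) = ker χ` for a cyclic layer `χ : Γ_K → ℤ/d` and `χ(s) = 1`, the `sʲ`, `j < d`, restrict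
to all of `Gal(E₀/K)` exactly once, so `∏_{j<d} sʲ k = N_{E₀/K}(k)` for `k ∈ E₀`
(Mathlib `Algebra.norm_eq_prod_automorphisms`). [cite: SerreLocalFields1979, XIII §4] -/
theorem prod_pow_smul_eq_algebraMap_norm {d : ℕ} [NeZero d] (χ : CyclicCharacter (absoluteGaloisGroup K) d)
    (E₀ : IntermediateField K (AlgebraicClosure K)) [FiniteDimensional K E₀] [IsGalois K E₀]
    (hker : χ.ker = galFixing K E₀) {s : absoluteGaloisGroup K} (hs : χ s = 1) (k : E₀) :
    ∏ j ∈ Finset.range d, (s ^ j) • (k : AlgebraicClosure K) =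
      algebraMap K (AlgebraicClosure K) (Algebra.norm K k) := by
  classical
  haveI : IsGalois K (AlgebraicClosure K) := IsGalois.mk
  set π : absoluteGaloisGroup K →* (E₀ ≃ₐ[K] E₀) :=
    (AlgEquiv.restrictNormalHom E₀).comp (absoluteGaloisGroup.toAlgEquiv K).toMonoidHom with hπ
  have hπsmul : ∀ (σ : absoluteGaloisGroup K) (x : E₀), ((π σ x : E₀) : AlgebraicClosure K) = σ • (x : AlgebraicClosure K) :=
    fun σ x => AlgEquiv.restrictNormal_commutes (absoluteGaloisGroup.toAlgEquiv K σ) E₀ x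
  have hπker : ∀ σ, π σ = 1 ↔ σ ∈ χ.ker := fun σ => by
    rw [hker]; exact restrictNormalHom_eq_one_iff E₀ σ
  -- `j ↦ π (s ^ j)` is injective on `range d`
  have hinj : Set.InjOn (fun j => π (s ^ j)) (Finset.range d : Set ℕ) := by
    have key : ∀ i j : ℕ, i < d → j < d → π (s ^ i) = π (s ^ j) → j ≤ i → i = j := by
      intro i j hi hj hij hji
      obtain ⟨m, rfl⟩ := Nat.exists_eq_add_of_le hji
      have h1 : π (s ^ m) = 1 := by
        have : π (s ^ (j + m)) = π (s ^ j) * π (s ^ m) := by rw [pow_add, map_mul]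
        rw [this] at hij
        exact mul_eq_left.mp hij
      rw [hπker, CyclicCharacter.mem_ker, χ.map_pow, hs] at h1
      have hm : (m : ZMod d) = 0 := by rw [← h1, nsmul_eq_mul, mul_one]
      rw [ZMod.natCast_eq_zero_iff] at hm
      have : m = 0 := Nat.eq_zero_of_dvd_of_lt hm (by omega)
      rw [this, add_zero]
    intro i hi j hj hij
    simp only [Finset.coe_range, Set.mem_Iio] at hi hj
    rcases le_total j i with h | h
    · exact key i j hi hj hij h
    · exact (key j i hj hi hij.symm h).symm
  -- and its image is everything: `#Gal(E₀/K) = [E₀ : K] = (Γ_K : ker χ) = d`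
  have hcard : Fintype.card (E₀ ≃ₐ[K] E₀) = d := by
    rw [← Nat.card_eq_fintype_card, IsGalois.card_aut_eq_finrank,
      IntermediateField.finrank_eq_fixingSubgroup_index, ← χ.index_ker, hker]
    exact (Subgroup.index_comap_of_surjective _ (absoluteGaloisGroup.toAlgEquiv K).surjective).symm
  have himage : (Finset.range d).image (fun j => π (s ^ j)) = Finset.univ := by
    apply Finset.eq_univ_of_card
    rw [Finset.card_image_of_injOn hinj, Finset.card_range, hcard]
  -- compute
  calc ∏ j ∈ Finset.range d, (s ^ j) • (k : AlgebraicClosure K)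
      = ∏ j ∈ Finset.range d, ((π (s ^ j) k : E₀) : AlgebraicClosure K) :=
        Finset.prod_congr rfl fun j _ => (hπsmul _ _).symm
    _ = ∏ g ∈ (Finset.range d).image (fun j => π (s ^ j)), ((g k : E₀) : AlgebraicClosure K) :=
        (Finset.prod_image (f := fun g : E₀ ≃ₐ[K] E₀ => ((g k : E₀) : AlgebraicClosure K))
          fun x hx y hy h => hinj hx hy h).symm
    _ = ((∏ g : E₀ ≃ₐ[K] E₀, g k : E₀) : AlgebraicClosure K) := by
        rw [himage]; push_cast; rfl
    _ = algebraMap K (AlgebraicClosure K) (Algebra.norm K k) := by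
        rw [← Algebra.norm_eq_prod_automorphisms]
        exact (IsScalarTower.algebraMap_apply K E₀ (AlgebraicClosure K) _).symm

end Galois

/-! ### Conversions between the additive module `K̄ˣ` and products of units -/

section Conversions

variable (F : Type u) [Field F]

/-- `N_s (ofUnits u) = ofUnits (∏_{k<n} sᵏ • u)`. [folklore] -/
theorem cycNorm_ofUnits (s : absoluteGaloisGroup F) (n : ℕ) (u : (AlgebraicClosure F)ˣ) :
    (units F).cycNorm s n (UnitsCarrier.ofUnits u) =
      UnitsCarrier.ofUnits (∏ k ∈ Finset.range n, (s ^ k) • u) := by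
  unfold ContinuousRep.cycNorm ContinuousRep.powSum
  change ∑ k ∈ Finset.range n, units F (s ^ k) (UnitsCarrier.ofUnits u) = Additive.ofMul (∏ k ∈ Finset.range n, (s ^ k) • u)
  rw [ofMul_prod]
  rfl

/-- The value of `∏_{k<n} sᵏ • u` in `F̄`. [folklore] -/
theorem coe_prod_pow_smul (s : absoluteGaloisGroup F) (n : ℕ) (u : (AlgebraicClosure F)ˣ) :
    (((∏ k ∈ Finset.range n, (s ^ k) • u : (AlgebraicClosure F)ˣ)) : AlgebraicClosure F) =
      ∏ k ∈ Finset.range n, (s ^ k) • (u : AlgebraicClosure F) := by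
  rw [Units.coe_prod]
  exact Finset.prod_congr rfl fun k _ => Units.coe_smul _ _

end Conversions

/-! ### The local data of a cyclic class which is locally a coboundary -/

section LocalData

variable {K : Type u} [Field K] [CharZero K]

/-- **Local analysis of a cyclic class.**  Let `χ : Γ_K → ℤ/d` be a cyclic layer with kernel
`Gal(K̄/E₀)`, `a ∈ Kˣ`, and `e` an explicit `2`-cocycle `Γ_K × Γ_K → K̄ˣ` whose class is the cyclic
class `κ_χ(a)`.  Let `L/K` be a field extension (a completion `K_v`) over which `e` becomes a
coboundary (pulled back along `Γ_L → Γ_K`, pushed into `L̄ˣ`).  Then, with the derived character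
`ψ` of `χ|_{Γ_L}` (of order `n`, kernel `Gal(L̄/L(E₀))`, `comap_galFixing_eq`) and `ψ(s) = 1`:
`κ_ψ(a) = 0` in `H²(Γ_L, L̄ˣ)` (functoriality, `map_cyclicClass_eq_cyclicClass_derived'`), hence
`a = N_s(b) = ∏_{k<n} sᵏ b` for some `b ∈ L(E₀)` (`exists_cycNorm_eq_of_cyclicClass_eq_zero` with
Hilbert 90 for `Gal(L̄/L(E₀))`) — the explicit local norm data consumed by
`IdeleHerbrand.hasseNorm_of_local` / `ArchHerbrand.exists_infUnits_norm_eq_of_local`.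
[cite: SerreLocalFields1979, XIII §3 Prop. 7, XIV §1 Prop. 3; CasselsFrohlichANT1967, Ch. VII §9.6] -/
theorem exists_localNormData (L : Type u) [Field L] [Algebra K L] [CharZero L]
    (e : absoluteGaloisGroup K → absoluteGaloisGroup K → (AlgebraicClosure K)ˣ)
    (f : contTwoCocycles (units K).toTopRep) (hf : ∀ σ τ, f.1 (σ, τ) = UnitsCarrier.ofUnits (e σ τ))
    {d : ℕ} [NeZero d] (χ : CyclicCharacter (absoluteGaloisGroup K) d)
    (E₀ : IntermediateField K (AlgebraicClosure K)) (hker : χ.ker = galFixing K E₀)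
    (aU : Kˣ) (a : (units K).toTopRep.ρ.invariants)
    (ha : (a : UnitsCarrier K) =
      UnitsCarrier.ofUnits (Units.map (algebraMap K (AlgebraicClosure K) : K →* AlgebraicClosure K) aU))
    (hz : twoCocycleClass _ f = cyclicClass χ (units K) a)
    (hlt : ∃ b : absoluteGaloisGroup L → (AlgebraicClosure L)ˣ, IsLocallyConstant b ∧ ∀ x y,
      Units.map (absClosureEmbedding K L : AlgebraicClosure K →* AlgebraicClosure L)
        (e (absGaloisRestrict K L x) (absGaloisRestrict K L y)) = b x * x • b y / b (x * y)) :
    ∃ (n : ℕ) (s : absoluteGaloisGroup L) (b : AlgebraicClosure L),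
      b ∈ IntermediateField.adjoin L (Set.range ((absClosureEmbedding K L).comp E₀.val)) ∧
      (∀ dd : absoluteGaloisGroup L, ∃ k < n,
        (s ^ k)⁻¹ * dd ∈ galFixing L (IntermediateField.adjoin L (Set.range ((absClosureEmbedding K L).comp E₀.val)))) ∧
      (∀ k < n, s ^ k ∈ galFixing L (IntermediateField.adjoin L (Set.range ((absClosureEmbedding K L).comp E₀.val))) →
        k = 0) ∧
      ∏ k ∈ Finset.range n, (s ^ k) • b =
        absClosureEmbedding K L (algebraMap K (AlgebraicClosure K) (aU : K)) := by
  classical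
  haveI : IsGalois L (AlgebraicClosure L) := IsGalois.mk
  -- the compatible pair `(res, ι)` on `K̄ˣ → L̄ˣ`
  obtain ⟨φ, hφ⟩ := exists_unitsHom (F := K) L
  set ψ := χ.derived (absGaloisRestrict K L) with hψdef
  have hψker : ψ.ker = galFixing L (IntermediateField.adjoin L (Set.range ((absClosureEmbedding K L).comp E₀.val))) := by
    rw [hψdef, CyclicCharacter.ker_derived, hker]
    exact comap_galFixing_eq L E₀
  -- the image of the class vanishes
  have hmap0 : ContinuousCohomology.map (absGaloisRestrict K L) φ 2 (twoCocycleClass _ f) = 0 := by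
    rw [map_twoCocycleClass]
    refine (twoCocycleClass_eq_zero_iff_exists_mul (F := L)
      (fun x y => Units.map (absClosureEmbedding K L : AlgebraicClosure K →* AlgebraicClosure L)
        (e (absGaloisRestrict K L x) (absGaloisRestrict K L y))) _ (fun x y => ?_)).mpr hlt
    rw [contTwoCocycles.pullback_apply, hf, hφ]
  -- the image of `a`
  have ha'inv : ∀ x : absoluteGaloisGroup L, (units L) x (φ.hom (a : UnitsCarrier K)) = φ.hom (a : UnitsCarrier K) := by
    intro x
    have h1 := TopRep.hom_comm_apply φ x (a : UnitsCarrier K)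
    change φ.hom (units K (absGaloisRestrict K L x) (a : UnitsCarrier K)) = (units L) x (φ.hom (a : UnitsCarrier K)) at h1
    have h2 : units K (absGaloisRestrict K L x) (a : UnitsCarrier K) = a := a.2 _
    rw [← h1, h2]
  let a' : (units L).toTopRep.ρ.invariants := ⟨φ.hom (a : UnitsCarrier K), ha'inv⟩
  have ha' : (a' : UnitsCarrier L) = UnitsCarrier.ofUnits
      (Units.map (absClosureEmbedding K L : AlgebraicClosure K →* AlgebraicClosure L)
        (Units.map (algebraMap K (AlgebraicClosure K) : K →* AlgebraicClosure K) aU)) := by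
    change φ.hom (a : UnitsCarrier K) = _
    rw [ha, hφ]
  have h0 : cyclicClass ψ (units L) a' = 0 := by
    rw [hψdef, ← map_cyclicClass_eq_cyclicClass_derived' χ (absGaloisRestrict K L) (units K) (units L) φ a a' rfl,
      ← hz, hmap0]
  -- membership of `a` in the compositum
  have hamem : absClosureEmbedding K L (algebraMap K (AlgebraicClosure K) (aU : K)) ∈
      IntermediateField.adjoin L (Set.range ((absClosureEmbedding K L).comp E₀.val)) :=
    IntermediateField.subset_adjoin _ _ ⟨algebraMap K E₀ (aU : K), rfl⟩
  by_cases hn1 : χ.compOrder (absGaloisRestrict K L) = 1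
  · -- trivial layer: `L(E₀) = L`, take `n = 1`, `s = 1`, `b = a`
    have htop : galFixing L (IntermediateField.adjoin L (Set.range ((absClosureEmbedding K L).comp E₀.val))) = ⊤ := by
      rw [← hψker, eq_top_iff]
      intro x _
      rw [CyclicCharacter.mem_ker]
      have : Subsingleton (ZMod (χ.compOrder (absGaloisRestrict K L))) := by rw [hn1]; infer_instance
      exact Subsingleton.elim _ _
    refine ⟨1, 1, absClosureEmbedding K L (algebraMap K (AlgebraicClosure K) (aU : K)), hamem,
      fun dd => ⟨0, Nat.one_pos, by rw [htop]; exact Subgroup.mem_top _⟩, fun k hk _ => by omega, ?_⟩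
    rw [Finset.prod_range_one, pow_zero, one_smul]
  · -- non-trivial layer: Hilbert 90 and `κ_ψ(a) = 0 ⇒ a = N_s b`
    have hn : 1 < χ.compOrder (absGaloisRestrict K L) :=
      lt_of_le_of_ne (χ.compOrder_pos (absGaloisRestrict K L)) (Ne.symm hn1)
    haveI : Fact (1 < χ.compOrder (absGaloisRestrict K L)) := ⟨hn⟩
    obtain ⟨s, hs⟩ := ψ.exists_map_eq_one
    have hT : Subsingleton (continuousCohomology 1 (((units L).restrict (subgroupIncl ψ.ker)).toTopRep)) := by
      rw [hψker]
      exact subsingleton_one_units_galFixing _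
    obtain ⟨b, hbT, hbN⟩ := exists_cycNorm_eq_of_cyclicClass_eq_zero ψ (units L) hs hT a' h0
    set bU : (AlgebraicClosure L)ˣ := (UnitsCarrier.toAdditive b).toMul with hbU
    have hbofU : b = UnitsCarrier.ofUnits bU := rfl
    refine ⟨χ.compOrder (absGaloisRestrict K L), s, (bU : AlgebraicClosure L), ?_, fun dd => ?_, fun k hk hmem => ?_, ?_⟩
    · -- `b ∈ L(E₀)`: fixed by `ker ψ = Gal(L̄/L(E₀))`
      rw [← InfiniteGalois.fixedField_fixingSubgroup
        (IntermediateField.adjoin L (Set.range ((absClosureEmbedding K L).comp E₀.val))),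
        IntermediateField.mem_fixedField_iff]
      intro g hg
      have hg' : (absoluteGaloisGroup.toAlgEquiv L).symm g ∈ ψ.ker := by
        rw [hψker]
        exact hg
      have := hbT _ hg'
      rw [hbofU, units_apply_ofUnits] at this
      have h2 := congrArg (fun v : (AlgebraicClosure L)ˣ => (v : AlgebraicClosure L)) (ofUnits_injective L this)
      rw [Units.coe_smul] at h2
      exact h2
    · -- coset representatives
      refine ⟨(ψ dd).val, ZMod.val_lt _, ?_⟩
      rw [← hψker, CyclicCharacter.mem_ker, ψ.map_mul, ψ.map_inv, ψ.map_pow, hs, nsmul_one,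
        ZMod.natCast_zmod_val, neg_add_cancel]
    · -- distinctness
      rw [← hψker, CyclicCharacter.mem_ker, ψ.map_pow, hs] at hmem
      have h1 : ((k : ℕ) : ZMod (χ.compOrder (absGaloisRestrict K L))) = 0 := by
        rw [← hmem, nsmul_eq_mul, mul_one]
      rw [ZMod.natCast_eq_zero_iff] at h1
      exact Nat.eq_zero_of_dvd_of_lt h1 hk
    · -- the product
      rw [hbofU, cycNorm_ofUnits, ha'] at hbN
      have h2 := congrArg (fun v : (AlgebraicClosure L)ˣ => (v : AlgebraicClosure L)) (ofUnits_injective L hbN)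
      change (((∏ k ∈ Finset.range _, (s ^ k) • bU : (AlgebraicClosure L)ˣ)) : AlgebraicClosure L) = _ at h2
      rw [coe_prod_pow_smul] at h2
      rw [h2]
      rfl

end LocalData

/-! ### The cyclic step over a number field -/

section Main

variable {K : Type u} [Field K] [NumberField K]

/-- The Galois group of the field of a cyclic layer is cyclic, generated by the restriction of any
`s` with `χ(s) = 1`. [folklore] -/
theorem isCyclic_of_cyclicLayer {d : ℕ} [NeZero d] (χ : CyclicCharacter (absoluteGaloisGroup K) d)
    (E₀ : IntermediateField K (AlgebraicClosure K)) [IsGalois K E₀] (hker : χ.ker = galFixing K E₀) :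
    IsCyclic (E₀ ≃ₐ[K] E₀) := by
  obtain ⟨s, hs⟩ := χ.exists_map_eq_one
  set π : absoluteGaloisGroup K →* (E₀ ≃ₐ[K] E₀) :=
    (AlgEquiv.restrictNormalHom E₀).comp (absoluteGaloisGroup.toAlgEquiv K).toMonoidHom with hπ
  have hπker : ∀ σ, π σ = 1 ↔ σ ∈ χ.ker := fun σ => by
    rw [hker]; exact restrictNormalHom_eq_one_iff E₀ σ
  have hπsurj : Function.Surjective π := fun g => by
    obtain ⟨τ, hτ⟩ := AlgEquiv.restrictNormalHom_surjective (AlgebraicClosure K) g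
    refine ⟨(absoluteGaloisGroup.toAlgEquiv K).symm τ, ?_⟩
    change AlgEquiv.restrictNormalHom E₀ ((absoluteGaloisGroup.toAlgEquiv K) ((absoluteGaloisGroup.toAlgEquiv K).symm τ)) = g
    rw [MulEquiv.apply_symm_apply, hτ]
  refine ⟨⟨π s, fun g => ?_⟩⟩
  obtain ⟨σ, rfl⟩ := hπsurj g
  refine ⟨((χ σ).val : ℤ), ?_⟩
  change π s ^ ((χ σ).val : ℤ) = π σ
  rw [zpow_natCast, ← map_pow]
  -- `σ = s^k t` with `t ∈ ker χ`
  have ht : (s ^ (χ σ).val)⁻¹ * σ ∈ χ.ker := by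
    rw [CyclicCharacter.mem_ker, χ.map_mul, χ.map_inv, χ.map_pow, hs, nsmul_one, ZMod.natCast_zmod_val,
      neg_add_cancel]
  have h1 : π ((s ^ (χ σ).val)⁻¹ * σ) = 1 := (hπker _).mpr ht
  rw [map_mul, map_inv, inv_mul_eq_one] at h1
  exact h1

/-- **The cyclic step of the Hasse principle for `H²(K, K̄ˣ)`.**  Let `K` be a number field,
`χ : Γ_K → ℤ/d` (`d > 1`) a cyclic layer with kernel `Gal(K̄/E₀)` for a finite Galois `E₀ ⊆ K̄`, and
`e : Γ_K × Γ_K → K̄ˣ` a locally constant `2`-cocycle which is a coboundary on `Gal(K̄/E₀)` and is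
locally a coboundary at every place of `K` (finite: over `K_v`; infinite: over `K_w`).  Then `e` is a
coboundary.  Proof (Cassels–Fröhlich VII §9.6 for the cyclic layer; Serre, *Corps locaux* XIII–XIV):
by Hilbert 90 and the computation of `H²` of a cyclic layer, `[e] = κ_χ(a)` for some `a ∈ Kˣ`
(`exists_cyclicClass_eq_of_res_eq_zero`); at each place the local triviality makes `a` a norm from
the local layer `K_v(E₀)` (`exists_localNormData`); by **Hasse's norm theorem**
(`IdeleHerbrand.hasseNorm_of_local`, with the archimedean conditions from
`ArchHerbrand.exists_infUnits_norm_eq_of_local`) `a = N_{E₀/K}(k)`, and `κ_χ(N k) = 0`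
(`cyclicClass_cycNorm`). [cite: CasselsFrohlichANT1967, Ch. VII §9.6; SerreLocalFields1979, XIV §1 Prop. 2–3] -/
theorem twoCocycle_cob_of_cyclicLayer
    (e : absoluteGaloisGroup K → absoluteGaloisGroup K → (AlgebraicClosure K)ˣ)
    (hlc : IsLocallyConstant fun p : absoluteGaloisGroup K × absoluteGaloisGroup K => e p.1 p.2)
    (hcoc : ∀ σ τ υ, e σ τ * e (σ * τ) υ = σ • e τ υ * e σ (τ * υ))
    {d : ℕ} [NeZero d] (hd : 1 < d) (χ : CyclicCharacter (absoluteGaloisGroup K) d)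
    (E₀ : IntermediateField K (AlgebraicClosure K)) [FiniteDimensional K E₀] [IsGalois K E₀]
    (hker : χ.ker = galFixing K E₀)
    (hkill : ∃ b : galFixing K E₀ → (AlgebraicClosure K)ˣ, IsLocallyConstant b ∧
      ∀ x y : galFixing K E₀, e x y = b x * (x : absoluteGaloisGroup K) • b y / b (x * y))
    (hfin : ∀ v : HeightOneSpectrum (𝓞 K),
      ∃ b : absoluteGaloisGroup (v.adicCompletion K) → (AlgebraicClosure (v.adicCompletion K))ˣ,
        IsLocallyConstant b ∧ ∀ x y,
          Units.map (absClosureEmbedding K (v.adicCompletion K) :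
              AlgebraicClosure K →* AlgebraicClosure (v.adicCompletion K))
            (e (absGaloisRestrict K (v.adicCompletion K) x) (absGaloisRestrict K (v.adicCompletion K) y)) =
          b x * x • b y / b (x * y))
    (hinf : ∀ w : InfinitePlace K,
      ∃ b : absoluteGaloisGroup w.Completion → (AlgebraicClosure w.Completion)ˣ,
        IsLocallyConstant b ∧ ∀ x y,
          Units.map (absClosureEmbedding K w.Completion : AlgebraicClosure K →* AlgebraicClosure w.Completion)
            (e (absGaloisRestrict K w.Completion x) (absGaloisRestrict K w.Completion y)) =
          b x * x • b y / b (x * y)) :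
    ∃ b : absoluteGaloisGroup K → (AlgebraicClosure K)ˣ, IsLocallyConstant b ∧
      ∀ σ τ, e σ τ = b σ * σ • b τ / b (σ * τ) := by
  classical
  haveI : Fact (1 < d) := ⟨hd⟩
  haveI : IsCyclic (E₀ ≃ₐ[K] E₀) := isCyclic_of_cyclicLayer χ E₀ hker
  -- the class of `e`
  obtain ⟨f, hf⟩ := exists_contTwoCocycles_eq e hlc hcoc
  -- `res_{ker χ} [e] = 0`
  haveI : CompactSpace χ.ker := isCompact_iff_compactSpace.mp χ.isClosed_ker.isCompact
  have hkill' : ∃ b : χ.ker → (AlgebraicClosure K)ˣ, IsLocallyConstant b ∧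
      ∀ x y : χ.ker, e x y = b x * (x : absoluteGaloisGroup K) • b y / b (x * y) := by
    obtain ⟨b, hb, hbe⟩ := hkill
    have hmem : ∀ x : χ.ker, (x : absoluteGaloisGroup K) ∈ galFixing K E₀ := fun x => hker ▸ x.2
    let ι : χ.ker → galFixing K E₀ := fun x => ⟨x, hmem x⟩
    have hι : Continuous ι := Continuous.subtype_mk continuous_subtype_val _
    exact ⟨fun x => b (ι x), hb.comp_continuous hι, fun x y => hbe (ι x) (ι y)⟩
  have hres : resH χ.ker (units K) 2 (twoCocycleClass _ f) = 0 :=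
    (resH_twoCocycleClass_eq_zero_iff_exists_mul χ.ker e f hf).mpr hkill'
  have hT : Subsingleton (continuousCohomology 1 (((units K).restrict (subgroupIncl χ.ker)).toTopRep)) := by
    rw [hker]; exact subsingleton_one_units_galFixing E₀
  obtain ⟨a, haz⟩ := exists_cyclicClass_eq_of_res_eq_zero χ (units K) hT _ hres
  -- `a ∈ Kˣ`
  obtain ⟨aU, haU⟩ := exists_units_map_algebraMap_eq K (UnitsCarrier.toAdditive (a : UnitsCarrier K)).toMul
    (fun σ => by
      apply ofUnits_injective K
      rw [← units_apply_ofUnits, ofUnits_toMul]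
      exact a.2 σ)
  have ha : (a : UnitsCarrier K) =
      UnitsCarrier.ofUnits (Units.map (algebraMap K (AlgebraicClosure K) : K →* AlgebraicClosure K) aU) := by
    rw [haU, ofUnits_toMul]
  -- local data at the finite and infinite places
  have hfinData := fun v : HeightOneSpectrum (𝓞 K) => by
    haveI : CharZero (v.adicCompletion K) := charZero_of_injective_algebraMap (algebraMap K _).injective
    exact exists_localNormData (v.adicCompletion K) e f hf χ E₀ hker aU a ha haz.symm (hfin v)
  have hinfData := fun w : InfinitePlace K => by
    haveI : CharZero w.Completion := charZero_of_injective_algebraMap (algebraMap K _).injective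
    exact exists_localNormData w.Completion e f hf χ E₀ hker aU a ha haz.symm (hinf w)
  -- Hasse's norm theorem for `E₀/K`
  haveI : CharZero E₀ := charZero_of_injective_algebraMap (algebraMap K E₀).injective
  haveI : NumberField E₀ :=
    { to_charZero := inferInstance
      to_finiteDimensional := Module.Finite.trans K E₀ }
  obtain ⟨k, hk⟩ := IdeleHerbrand.hasseNorm_of_local (K := K) (E := E₀) E₀.val aU hfinData fun u => by
    obtain ⟨n, s, b, -, hcov, hinj, hprod⟩ := hinfData u
    exact ArchHerbrand.exists_infUnits_norm_eq_of_local u E₀.val aU n s b hcov hinj hprod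
  -- `κ_χ(N k) = 0`
  obtain ⟨s₀, hs₀⟩ := χ.exists_map_eq_one
  set kU : (AlgebraicClosure K)ˣ :=
    Units.map (algebraMap E₀ (AlgebraicClosure K) : E₀ →* AlgebraicClosure K) k with hkU
  have hkT : ∀ t ∈ χ.ker, units K t (UnitsCarrier.ofUnits kU) = UnitsCarrier.ofUnits kU := by
    intro t ht
    rw [hker, mem_galFixing_iff] at ht
    rw [units_apply_ofUnits]
    refine congrArg _ (Units.ext ?_)
    rw [Units.coe_smul]
    exact ht _ (k : E₀).2
  have hnorm : (units K).cycNorm s₀ d (UnitsCarrier.ofUnits kU) = (a : UnitsCarrier K) := by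
    rw [cycNorm_ofUnits, ha]
    refine congrArg _ (Units.ext ?_)
    rw [coe_prod_pow_smul]
    change ∏ j ∈ Finset.range d, (s₀ ^ j) • ((k : E₀) : AlgebraicClosure K) =
      algebraMap K (AlgebraicClosure K) (aU : K)
    rw [prod_pow_smul_eq_algebraMap_norm χ E₀ hker hs₀, hk]
  have hκ0 : cyclicClass χ (units K) a = 0 := by
    have h := cyclicClass_cycNorm χ (units K) hs₀ hkT
    have ha' : a = ⟨(units K).cycNorm s₀ d (UnitsCarrier.ofUnits kU), apply_cycNorm_eq χ (units K) hs₀ hkT⟩ :=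
      Subtype.ext hnorm.symm
    rw [ha']
    exact h
  rw [hκ0] at haz
  exact (twoCocycleClass_eq_zero_iff_exists_mul e f hf).mp haz.symm

end Main



end Literature.NumberTheory.GaloisRepresentations
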